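import Mathlib
import HarnessLib
import HarnessLib.Audit
import Summits.CriticalPhenomena.Statement
import Literature.Probability.RandomPlanarGeometry.HexParafermion
import Literature.Probability.RandomPlanarGeometry.HexSAW
import Literature.Probability.RandomPlanarGeometry.SLEConvergenceCriterion
import Literature.Probability.RandomPlanarGeometry.ConformalMap
import HarnessLib.Audit.Status.Attr

/-!
Route: SAWPhaseRetrieval

DORMANT since 2026-08-26T10:52:11Z (reconciler: no traction for 8.3 d (last activity item-evidence-added at 2026-08-18T02:01:51Z); parked, not closed — `ledger route dormant route-CriticalPhenomena-SAWPhaseRetrieval --off` to reactivate) — unstaffed, not closed; items shared with open routes are served there. `ledger route dormant <id> --off` reactivates.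

# Route SAWPhaseRetrieval — argument over modulus — tilted-winding phase law plus discrete magnitude
retrieval give DCS Conjecture 2 on the hexagonal lattice

It suffices to show X = HexObservableLimitR — the averaged, b-normalised form of
Duminil-Copin–Smirnov 2012 Conjecture 2 on the
HEXAGONAL lattice with the ROOT PINNED CONFORMALLY (rev 5 repair): one universal c ≠ 0 with δ² Σ_e
ψ(δe) F_δ(e)/F_δ(b_δ) → c ∫ ψ exp((5/8)(L − L_b))
for every Dobrushin domain flat (horizontal, domain above) near BOTH marked points, every admissible
simply connected discretisation that is the exact
half-lattice (rows ≥ m_i(δ)) in a ball at b AND in a ball at the root a, every ψ ∈ C_c(Ω); F_δ = DCS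
parafermionic observable, σ = 5/8, x = x_c,
rooted at the boundary mid-edge a_δ → a; φ' = exp L, φ : Ω → ℍ, a ↦ ∞, b ↦ 0. X is SHARED VERBATIM
with route SAWDefectDecoherence
(item stmt-CriticalPhenomena-14003, the refuter's repair variant (1); rev 6 re-aligned this route's
rev-5 variant onto it so that one proof of X and of
ObservableToSLER serves every sibling). The un-pinned form HexObservableLimit
(stmt-CriticalPhenomena-5420, the old shared target of five routes) is REFUTED
(SAWDefectDecoherenceHexObservableLimit_refuted: a one-cell corridor
hugging ∂Ω relocates the conformally effective root while every hypothesis holds) and stays in the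
negatives index; X is 5420 plus exactly one
hypothesis, the rigid half-lattice ball at pt 0 (what 5420 already asked at pt 1), which excludes
both corridor configurations: a forced one-cell
channel ending at the root cannot live inside the rigid ball. X is reached by the card
argument-over-modulus-parafermion: write F = ρ e^{iψ}; the DCS vertex relations (PROVED,
DuminilCopinSmirnov2012_lemma1_holds) are, for GIVEN phases ψ,
a real-linear system for the moduli with 4E/3 equations and E unknowns whose kernel at an isotropic
phase field is the constants. Hence
X ⇐ PhaseLawR (the ARGUMENT of F_δ(e)/F_δ(b_δ) converges to that of (φ'/φ'(b))^{5/8}, uniformly on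
compacts, all three edge classes alike; same pinned
setting) ∧ RetrievalStabilityR (conditional stability of the real system on preconnected compacts:
ε-correct phases ⇒ moduli = one positive scalar ×
|φ'|^{5/8} up to η in L¹, for EVERY solution of the vertex relations) ∧ BoundaryAnchoring (the one
free scalar is pinned at b: just inside the flat
zigzag piece |F_δ(e)|/|F_δ(b_δ)| → universal c > 0), glued by RetrievalSynthesisR; downstream the
shared pipeline HexTight, ObservableToSLER
(X → HexTight → DCS Conjecture 1) of the sibling routes SAWDefectDecoherence / SAWResidueField /
SAWWindingAlias / SAWDevelopingMap, then ONE transfer crux HexTransfer (DCS Conjecture 1, written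
out → SAWScalingLimit: lattice universality in the implicational form the assembly needs; rev 7
route choice — it replaces in THIS route the shared tail HexConjecture → HexToSquare +
LatticeUniversality, which stays with the siblings).
Lean: `∃ c : ℂ, c ≠ 0 ∧ ∀ (D : Literature.Probability.RandomPlanarGeometry.DobrushinDomain) (ρ : ℝ)
(Λ : ℝ → Finset Literature.Probability.LatticeModels.HexVertex) (m : Fin 2 → ℝ → ℤ) (a b : ℝ → Sym2
Literature.Probability.LatticeModels.HexVertex) (Φ :
Literature.Probability.RandomPlanarGeometry.ConformalEquiv D.carrier
UpperHalfPlane.upperHalfPlaneSet) (L : ℂ → ℂ) (Lb : ℂ) (ψ : ℂ → ℂ), let F : ℝ → Sym2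
Literature.Probability.LatticeModels.HexVertex → ℂ := fun δ z =>
Literature.Probability.RandomPlanarGeometry.SAW.hexParafermionicObservable (Λ δ) (a δ)
Literature.Probability.RandomPlanarGeometry.SAW.hexCriticalFugacity (5 / 8) z; 0 < ρ → (∀ i : Fin 2,
D.carrier ∩ Metric.ball (D.pt i) ρ = {z : ℂ | (D.pt i).im < z.im} ∩ Metric.ball (D.pt i) ρ) → (∀ᶠ δ
: ℝ in nhdsWithin 0 (Set.Ioi 0),
Literature.Probability.RandomPlanarGeometry.SAW.hexDomainSimplyConnected (Λ δ) ∧ a δ ∈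
Literature.Probability.RandomPlanarGeometry.SAW.hexDomainBoundary (Λ δ) ∧ b δ ∈
Literature.Probability.RandomPlanarGeometry.SAW.hexDomainBoundary (Λ δ) ∧ Nonempty
(Literature.Probability.RandomPlanarGeometry.SAW.HexMidEdgeSAW (Λ δ) (a δ) (b δ)) ∧
(Literature.Probability.LatticeModels.hexGraph.induce ((Λ δ : Finset
Literature.Probability.LatticeModels.HexVertex) : Set
Literature.Probability.LatticeModels.HexVertex)).Preconnected ∧ (∀ v ∈ Λ δ, (δ : ℂ) *
Literature.Probability.LatticeModels.hexCenter v ∈ D.carrier) ∧ (∀ i : Fin 2, ∀ v :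
Literature.Probability.LatticeModels.HexVertex, (δ : ℂ) *
Literature.Probability.LatticeModels.hexCenter v ∈ Metric.ball (D.pt i) ρ → (v ∈ Λ δ ↔ m i δ ≤ v.1
1))) → (∀ K : Set ℂ, IsCompact K → K ⊆ D.carrier → ∀ᶠ δ : ℝ in nhdsWithin 0 (Set.Ioi 0), ∀ v :
Literature.Probability.LatticeModels.HexVertex, (δ : ℂ) *
Literature.Probability.LatticeModels.hexCenter v ∈ K → v ∈ Λ δ) → Filter.Tendsto (fun δ : ℝ => (δ :
ℂ) * Literature.Probability.RandomPlanarGeometry.SAW.hexMidpoint (a δ)) (nhdsWithin 0 (Set.Ioi 0))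
(nhds (D.pt 0)) → Filter.Tendsto (fun δ : ℝ => (δ : ℂ) *
Literature.Probability.RandomPlanarGeometry.SAW.hexMidpoint (b δ)) (nhdsWithin 0 (Set.Ioi 0)) (nhds
(D.pt 1)) → Filter.Tendsto (fun x => ‖Φ x‖) (nhdsWithin (D.pt 0) D.carrier) Filter.atTop →
Φ.HasBoundaryValue (D.pt 1) 0 → ContinuousOn L D.carrier → (∀ z ∈ D.carrier, Complex.exp (L z) =
deriv Φ z) → Filter.Tendsto L (nhdsWithin (D.pt 1) D.carrier) (nhds Lb) → Continuous ψ →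
HasCompactSupport ψ → tsupport ψ ⊆ D.carrier → Filter.Tendsto (fun δ : ℝ => (δ : ℂ) ^ 2 * (∑ᶠ e ∈
Literature.Probability.RandomPlanarGeometry.SAW.hexDomainMidEdges (Λ δ), ψ ((δ : ℂ) *
Literature.Probability.RandomPlanarGeometry.SAW.hexMidpoint e) * F δ e) / F δ (b δ)) (nhdsWithin 0
(Set.Ioi 0)) (nhds (c * ∫ z, ψ z * Complex.exp ((5 / 8 : ℂ) * (L z - Lb))))`

## Assembly
Crux-only deciding theorem (rev 11; rule of 2026-08-16: every hypothesis of `closes` is a declared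
crux, glue/support are proved lemmas inside its proof):
`theorem closes (hX : HexObservableLimitR) (hT : HexTight) (hO : ObservableToSLER) (hTr :
HexTransfer) : SAWScalingLimit := hTr (hO hX hT)` — the thesis X,
a declared CRUX of this route since rev 10 (it is DCS Conjecture 2, conjecture-grade; a
conjecture-grade target/support is no longer a kind), with HexTight gives
DCS Conjecture 1 on the hexagonal lattice through ObservableToSLER (written out; the siblings' node
HexConjecture by Iff.rfl); HexTransfer carries it to δℤ².
Layer 1 (this route's mechanism = the registered derivation of X) = PhaseLawR, RetrievalStabilityR
(+ its disc case RetrievalStabilityDisc and the entry lemma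
LocalIsotropy), BoundaryAnchoring, glued into X by the SUPPORT lemma RetrievalSynthesisR : PhaseLawR
→ RetrievalStabilityR → BoundaryAnchoring → HexObservableLimitR
(pure analysis, difficulty M, to be PROVED — under the crux-only rule it may not be a hypothesis of
`closes`; once RetrievalSynthesisR_holds lands, `closes` can be
rewritten over the three mechanism cruxes as hTr (hO (RetrievalSynthesisR_holds hP hR hB) hT)); the
projective hub 'Conjecture 2 up to one complex scalar per (compact, mesh)' — ex-support
ProjectiveObservableLimitR, stmt-CriticalPhenomena-14015, conjecture-grade by its own docstring and
derived or used by no item — was DROPPED at rev 12 (its typed, refuter-checked statement stays in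
the ledger as the fall-back deliverable named under KILL CRITERIA, to be re-filed as a crux only if
BoundaryAnchoring dies);
layer 2 (pipeline) = HexTight, ObservableToSLER (both shared), HexTransfer. ROUTE CHOICE
(smuggled-conjecture hold of 2026-08-16; option (a) DROP ITEMS): every
conjecture-grade item must be a crux and a thin route has at most 7 — rev 7 dropped from THIS route
only the named node HexConjecture (stmt-0808), the glue
HexToSquare (stmt-10473) and LatticeUniversality (stmt-0807) (they stay with the four siblings that
share them) and replaced them by the single crux HexTransfer,
which HexToSquare ∧ LatticeUniversality implies; rev 10 re-kinded X target → crux and rev 11 made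
`closes` crux-only: 7 cruxes (X, PhaseLawR, RetrievalStabilityR,
BoundaryAnchoring, HexTight, ObservableToSLER, HexTransfer), and after rev 12 (gen-4 route choice:
drop the last conjecture-grade NON-crux item, the support ProjectiveObservableLimitR) 3 supports
(RetrievalSynthesisR, RetrievalStabilityDisc, LocalIsotropy — glue of difficulty M, a special case
of #3, an elementary lemma), 10 items, no conjecture-grade non-crux item by any reading (docstring,
difficulty tag or substance). The second thesis one could split off —
"X ⇒ SAWScalingLimit via tightness, the martingale identification and lattice universality" — is
exactly the shared pipeline and is NOT filed as a new route
(planning freeze).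

Rationale: WHY THIS LINE. The half-Cauchy–Riemann barrier counts COMPLEX equations (V ≈ 2E/3 for E unknowns);
counted as a REAL system with the argument
field as datum, DCS Lemma 1 is over-determined by E/3: at every vertex the three terms (p−v)F(p),
(q−v)F(q), (r−v)F(r) close a
triangle, so ε-equal arguments force moduli equal up to 1 ± 4ε (LocalIsotropy, law of sines) and the
remaining slowly varying
scale obeys a discrete ∂̄-equation driven by the phase defect — the lattice form of "a holomorphic
function is determined by its
argument up to a positive constant" (harmonic conjugate), valid for HALF-holomorphic fields because
half of CR plus all of the
argument already exceeds the count; two in-session computations back this: the Bloch symbol of the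
linearised real operator on the
honeycomb has σ_min(k) ≥ 0.418·min(|k|,1) with kernel = constants (no zone-edge degeneracy), and for
the exact DCS field in honeycomb
balls up to E = 111 mid-edges the retrieval kernel is exactly ℝ·|F| with second singular value ≈
0.42|k|_min (polynomial, not
exponential). The phase is the probabilistically ROBUST half (Werness2012: F = mass × E[e^{−iσW}]; ψ
= −(5/8)×the tilted circular mean
of the arrival winding, exact on boundary mid-edges and symmetry axes, blind to the exponents 5/8,
5/48 and to the diverging winding
variance, which all sit in the modulus), so Conjecture 2 is reduced to conformal covariance of ONE
bounded directional statistic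
(PhaseLawR), a piece of discrete elliptic analysis (RetrievalStabilityR, stated in L¹ on
preconnected compacts because the sup-norm version fails already in the
continuum: the log-scale is a Beurling transform of the phase defect, L∞ → BMO only) and a
boundary-layer constant (BoundaryAnchoring,
where Werness's coincidence b − b̃ − ν = 5/8 − 5/48 − 25/48 = 0 lives). Imported areas: discrete
complex analysis / inverse problems
(conditional stability, three-balls: GuadieMalinnikova2014 = arXiv:1306.1418, arXiv:2003.00491;
Chelkak–Smirnov arXiv:0810.2188),
Calderón–Zygmund/BMO (Beurling transform), winding laws of polymers (DuplantierSaleur1988,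
PriceEtAl2012 =
doi:10.1088/1751-8113/45/27/275002, Werness2012 = arXiv:1110.3731). What prior routes do not do:
SAWParafermion / SAWHexUniversality keep
Conjecture 2 (resp. Conjecture 1) as one opaque crux; SAWResidueField completes the missing half
VARIATIONALLY (Hodge split, residue
energy → 0); this route completes it by DATA (the argument) and real over-determination —
complementary mechanisms feeding one shared
target; the negatives index (all-δ tightness 0772) is avoided by the eventual IsTightAlongMesh form
(HexTight). REPAIR NOTE (rev 5): the shared target 5420 fell to a MISSTATEMENT, not to the mechanism
— its hypotheses pinned the root a_δ only metrically (δ·mid a_δ → a) and a boundary-hugging one-cell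
corridor moves the conformally effective root (SAWDefectDecoherenceHexObservableLimit_refuted);
every root-sensitive statement of the line (target, PhaseLaw, ProjectiveObservableLimit) is re-filed
with the root pinned exactly as b is — flat piece + exact half-lattice in a ρ-ball at BOTH marked
points (suffix R; the target verbatim the sibling SAWDefectDecoherence's item 14003, rev 6
alignment), the root-free ones (RetrievalStabilityR, BoundaryAnchoring, LocalIsotropy,
RetrievalStabilityDisc, HexTight, LatticeUniversality, HexConjecture, HexToSquare) are untouched,
and the vacuous implications through 5420 (ObservableToSLE, RetrievalSynthesis, AnchoredSynthesis)
are replaced by ObservableToSLER / RetrievalSynthesisR. ROUTE-CHOICE NOTE (rev 7): the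
smuggled-conjecture audit counts every conjecture-grade item as a crux (cap 7); with the target X
and the glue HexToSquare the route had 9. X cannot go (it is the thesis, named by the shared decls
RetrievalSynthesisR/ObservableToSLER) and HexToSquare is a `closes` hypothesis, so the ℤ²-transfer
tail HexConjecture (0808) → HexToSquare (10473) + LatticeUniversality (0807) leaves THIS route (the
siblings keep it) and the one crux HexTransfer (Conjecture 1 → SAWScalingLimit) replaces it: 6
cruxes + X = 7, 11 items, mechanism untouched. ROUTE-CHOICE NOTE (rev 10–11): the crux-only
deciding-theorem rule (2026-08-16) flagged `closes` for assuming the support RetrievalSynthesisR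
(glue.non-crux-hypothesis); rather than badge glue as a crux, X itself — conjecture-grade, hence a
crux under the same rule (rev 10: target → crux, as in the sibling SAWDefectDecoherence) — is the
`closes` hypothesis (rev 11: closes := hTr (hO hX hT) over X, HexTight, ObservableToSLER,
HexTransfer) and RetrievalSynthesisR stays the support lemma deriving X from the three mechanism
cruxes (to be proved; `closes` can then be rewritten over PhaseLawR, RetrievalStabilityR,
BoundaryAnchoring). Count: 7 cruxes incl. X = cap, 4 supports (RetrievalSynthesisR,
ProjectiveObservableLimitR, RetrievalStabilityDisc, LocalIsotropy), 11 items; nothing dropped, no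
statement text changed. ROUTE-CHOICE NOTE (rev 12, gen 4): option (a) completed in substance — the
human rule behind the audit is 'a conjecture-grade statement is a crux or it is not on the route';
the one item still violating it in substance though not by the audit's regex, the support
ProjectiveObservableLimitR (stmt-14015: Conjecture 2 up to one complex scalar per (compact, mesh);
docstring [difficulty: open-problem]; not a `closes` hypothesis, derived by no item since
ProjectiveSynthesis 8315 fell with 8312, used by none), cannot be promoted (cap full) and is
DROPPED: 7 cruxes = cap, 3 supports, 10 items, `closes` unchanged; its statement stays in the ledger
(moot) as the typed fall-back deliverable. Option (b) is recorded, not executed: the mechanism half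
(PhaseLawR ∧ RetrievalStabilityR ∧ BoundaryAnchoring ⇒ X) alone does not reach SAWScalingLimit and
the pipeline half alone duplicates SAWDefectDecoherence, so neither half can be retired.

RANKED CRUXES. #0 HexObservableLimitR (crux since rev 10 — the thesis X and a `closes` hypothesis;
kind target before) — DCS 2012 Conjecture 2 on the hexagonal lattice, averaged against bulk test
functions and normalised at one boundary mid-edge b_δ of a flat good-zigzag boundary piece, with the
root pinned conformally (flat piece + exact half-lattice in ball(p_i, ρ) at both marked points,
shared item 14003): ∃ c ≠ 0 universal; δ²⟨ψ, F_δ⟩/F_δ(b_δ) → c ∫ ψ exp((5/8)(L − L_b)) — the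
repaired form of the refuted shared target stmt-CriticalPhenomena-5420 (one hypothesis added; the
old statement implies it). (why it might fail: Conj. 2 open since 2010: fails if the limit 1-form
keeps a dz̄ part, if the three edge classes split, or if the b-normalisation oscillates in δ
(Kennedy–Lawler); the collar away from the two rigid balls stays free — a witness moving the
conformal geometry from there would re-misstate it.) [DuminilCopinSmirnov2012, arXiv:1007.0575,
Smirnov2007ICM, KennedyLawler2013, Werness2012, SAWDefectDecoherenceHexObservableLimit_refuted]
#2 PhaseLawR (crux) — PHASE LAW (card A2) in the pinned setting of the target (both marked points):
ONE universal unit u (|u| = 1) such that for every compact K ⊂ Ω and ε > 0, eventually in δ, F_δ(e)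
≠ 0 and the unit vector of F_δ(e)/F_δ(b_δ) is within ε of u·exp(i(5/8)·Im(L(δe) − L_b)) for EVERY
mid-edge e in K (all three edge classes: one common limit) — the argument half of Conjecture 2;
probabilistically the (5/8)-tilted circular mean of the arrival winding of walks a → e, measured
against the fixed winding a → b, tends to −(arg φ'(z) − arg φ'(b)). Repaired form of PhaseLaw (8311,
misstated like 5420: identical ratios, different predicted phases in the corridor pair). (why it
might fail: Weaker than Conj. 2 but still conformal covariance: hexagonal anisotropy may survive at
O(1) in the tilted mean arrival winding (three edge classes, ONE limit), F_δ may vanish on compacts,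
and no engine beyond restriction/Hadamard-variation heuristics exists at n = 0.)
[DuminilCopinSmirnov2012, Werness2012, DuplantierSaleur1988, PriceEtAl2012, Smirnov2007ICM,
KennedyLawler2013]
#3 RetrievalStabilityR (crux) — RETRIEVAL STABILITY (card A3, L¹ form, preconnected K; repaired form
of 8312): for open Ω, L holomorphic on Ω, Λ_δ exhausting compacts of Ω, every PRECONNECTED compact
K, r > 0 with cthickening r K ⊆ Ω and η > 0 there is ε > 0 such that for all small δ EVERY G solving
the DCS vertex relations on Λ_δ, non-zero with unit vector within ε of exp(i(5/8)Im L(δe)) on the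
mid-edges of the r-thickening, admits s > 0 with δ² Σ_{e∈K} | |G e|/s − |exp((5/8)L(δe))| | ≤ η —
"argument determines modulus up to one positive constant", stably and uniformly in the mesh, for
half-holomorphic lattice fields; no root, no probability. (why it might fail: 8312 died on
DISCONNECTED K; IsPreconnected K excludes that. Left: δ-uniform interior L¹ estimate for PL
(1+O(ε))-quasiregular lattice maps with ε-rotation — no rate in K→1 from AIM 5.5.1/13.4.4;
variable-L patching; sup form false.) [DuminilCopinSmirnov2012, AstalaIwaniecMartin2008,
LehtoVirtanen1973, RodinSullivan1987, arXiv:1306.1418, arXiv:0810.2188]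
#4 BoundaryAnchoring (crux) — BOUNDARY ANCHORING: a universal c > 0 such that in the flat-zigzag
setting at b (a_δ → a, b_δ → b, exact half-lattice in ball(b, ρ)) for every ε > 0 some closed ball B
⊂ Ω within distance ε of b carries, eventually in δ, | |F_δ(e)|/|F_δ(b_δ)| − c | ≤ ε for all
mid-edges e in B — the one positive scalar left free by retrieval is pinned through the boundary
layer at b. Unaffected by the 5420 witness: its prediction near b is φ-free and the exact
half-lattice keeps corridors at distance ≥ ρ from b. (why it might fail: Hides the exponent
conspiracy |F(z)| = mass × |E e^{-iσW}|: the bulk–boundary gap 25/48 must equal the winding decay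
κσ²/2 with matching amplitudes (Werness b−b̃−ν = 0); Kennedy–Lawler lattice effects could make c
depend on more than the zigzag class, or oscillate in δ.) [Werness2012, KennedyLawler2013,
DuplantierSaleur1988, DuminilCopinSmirnov2012, BeatonGuttmannJensen2012]
#5 HexTight (crux) — eventual tightness of the critical hexagonal SAW laws along 𝓝[>]0
(IsTightAlongMesh; NOT the refuted all-δ form 0772); shared item stmt-CriticalPhenomena-5423. (why
it might fail: No RSW/annulus-crossing technology for SAW (n = 0: no FKG; KS17 §4 covers FK,
percolation, harmonic explorer, LERW; G2 fails for UST §4.5); strongest inputs: sub-ballisticity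
(DCH13, arXiv:2310.17299).) [KemppainenSmirnov2017, DuminilCopinHammond2013, arXiv:2310.17299,
arXiv:1212.6215, Summit.CriticalPhenomena.SAWScalingLimit.Theorems.SAWParafermionTight_refuted]
#6 ObservableToSLER (crux) — the martingale-observable identification over the repaired target:
HexObservableLimitR → HexTight → DCS Conjecture 1 (written out; = item HexConjecture): e^{-iσW}·⟨ψ,
F_{Ω∖γ[0,n]}⟩/F_{Ω∖γ[0,n]}(b) is an exact discrete martingale (domain Markov property, winding
additivity), its limit forces the driving process of every subsequential limit to be √(8/3)B (2β +
κβ(β−1)/2 = 2α with (α, β) = (5/8, −5/4)), tightness + uniqueness of the SLE law conclude; replaces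
the now vacuous ObservableToSLE (10472). [deps: HexObservableLimitR, HexTight] (why it might fail:
The martingale needs the observable limit in the SAW's own slit domains, uniformly (Carathéodory),
with a rough tip as root; HexObservableLimitR is per fixed Jordan domain, flat at b. Projective data
fix κ = 8/3 but not the drift, so the b-normalisation is load-bearing.) [LawlerSchrammWerner2003,
KemppainenSmirnov2017, DuminilCopinSmirnov2012Clay, Smirnov2007ICM, DuminilCopinSmirnov2012,
arXiv:math/0209343]
#7 HexTransfer (crux) — LATTICE-UNIVERSALITY TRANSFER: DCS 2012 Conjecture 1 (hexagonal critical SAW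
→ chordal SLE(8/3) for every Dobrushin domain and hexagonal endpoint approximation; written out,
verbatim the conclusion of ObservableToSLER and Iff.rfl the siblings' shared node HexConjecture
stmt-0808) IMPLIES SAWScalingLimit on δℤ² — universality in the implicational form the assembly
needs, weaker than LatticeUniversality (stmt-0807: asymptotic equality of laws) and implied by
HexToSquare ∧ LatticeUniversality (Sketch.lean); replaces that shared tail here (rev 7). (why it
might fail: its open content is lattice universality — uniform ℤ² SAW lies in no
Yang–Baxter/integrable family (GM19 p.1; barrier NienhuisWeightsExcludeVertexSAW), no transfer tool
exists even given the hexagonal limit; Kennedy–Lawler boundary lattice effects.)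
[GlazmanManolescu2019, KennedyLawler2013, DuminilCopinSmirnov2012, LawlerSchrammWerner2004SAW,
Literature.Barriers.CriticalPhenomena.NienhuisWeightsExcludeVertexSAW,
Literature.Barriers.CriticalPhenomena.not_hasExactVertexRelationZ2]
SUPPORT (rank 9): RetrievalSynthesisR — layer-1 glue PhaseLawR → RetrievalStabilityR →
BoundaryAnchoring → HexObservableLimitR (rotate by the unit at b, Lemma 1 linearity, stability on a
preconnected compact containing tsupport ψ and an anchoring ball, pin the scalar on the ball,
honeycomb Riemann sums with mid-edge density 2√3; difficulty M) [DuminilCopinSmirnov2012,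
arXiv:0810.2188]; RetrievalStabilityDisc — the disc case Ω = ball 0 3, L = 0 of #3 (stepping stone;
implied by #3 by instantiation) [DuminilCopinSmirnov2012]; LocalIsotropy — triangle closure at one
vertex, | |G(vp)|/|G(vq)| − 1 | ≤ 4ε (provable now) [DuminilCopinSmirnov2012]. (Dropped from this
route at rev 7, kept by the siblings: HexToSquare stmt-10473, HexConjecture stmt-0808,
LatticeUniversality stmt-0807. Dropped at rev 12, unique to this route, moot:
ProjectiveObservableLimitR stmt-14015 — the hub 'Conjecture 2 up to one complex scalar per (compact,
mesh), in L¹' in the pinned setting, conjecture-grade, the fall-back deliverable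
[DuminilCopinSmirnov2012, Werness2012].)

TWO-LAYER PLAN. Standing layer (all items filed): X = HexObservableLimitR ⇐ PhaseLawR +
RetrievalStabilityR + BoundaryAnchoring, glue RetrievalSynthesisR (support, to be proved; a formal
`--split` over the existing decls is not re-issued). Foreseen glued splits (k ≤ 3, depth 1), filed
only when a crux moves: RetrievalStabilityR ⇐ SymbolEllipticity (the 4×3 Bloch symbol of the
linearised real operator is injective off k = 0 with σ_min ≥ c·min(|k|,1) — computed 0.418
in-session; a finite certified computation) →
DiscreteDivCurlBMO (δ-uniform interior L¹/BMO estimate for the variable-coefficient real system from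
LocalIsotropy + a discrete
Calderón–Zygmund / John–Nirenberg argument on the honeycomb) → RetrievalStabilityR; PhaseLawR ⇐
SymmetricAnchors (exact phases on symmetry
axes and boundary mid-edges of symmetric domains, all meshes) → PhaseHadamardVariation
(domain-monotone control of the tilted mean winding
under shrinking the domain: restriction + winding additivity) → PhaseLawR; BoundaryAnchoring ⇐
BoundaryLayerLocality (the near-b modulus
ratio is asymptotically independent of the far geometry) → TwoScaleAmplitude (mass growth × winding
decay = constant across δ ≪ y ≪ 1) →
BoundaryAnchoring; HexTransfer ⇐ HexEndpointApproxExists (hexagonal endpoint approximations exist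
for every Dobrushin domain — the ℤ² twin is proved; cf. the sibling item of SAWMassiveIsingTilt) →
TransferGivenLimit (ℤ² minus hexagonal test integrals → 0 GIVEN the hexagonal SLE(8/3) limit; the
open core) → HexTransfer (two-ε gluing); ObservableToSLER ⇐ SlitUniformObservable (incl. rough roots
beyond the flat class) → LoewnerRegularity → ObservableToSLER (as in the sibling routes).

KILL CRITERIA. ¬PhaseLawR exhibited (an O(1) edge-class-dependent or anisotropic pattern in the
tilted mean arrival winding, stable under refinement, in an
HONEST discretisation family — exact flat-zigzag half-lattice near the root AND near b; witnesses
that only move the root inside the o(1)-collar, like the corridor of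
SAWDefectDecoherenceHexObservableLimit_refuted, are excluded by the pinned hypotheses and say
nothing about the line) refutes Conjecture 2 as printed for that
family and closes the route (`close --reason refuted:PhaseLawR`), the witness going to the sibling
routes as negative knowledge. ¬RetrievalStabilityR (a
δ-family of vertex-relation solutions on a PRECONNECTED compact with ε_δ → 0 phase defect and
L¹-modulus deviation bounded below) kills the mechanism: pivot
once to stability restricted to fields with the SAW observable's positivity/monotonicity structure,
else close `refuted:RetrievalStabilityR`.
¬BoundaryAnchoring with PhaseLawR and RetrievalStabilityR standing ⇒ pivot: re-file the projective
observable limit (the rev-12-dropped support ProjectiveObservableLimitR, stmt-14015, then as a CRUX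
in place of BoundaryAnchoring) as the delivered statement and re-anchor by flux
through a boundary arc (SAWResidueField's foreseen BoundaryFluxCovariance) or restate the target
with c depending on the discrete class at b. A further
MISSTATEMENT-type refutation of HexObservableLimitR (a witness acting from the free collar away from
both rigid balls) ⇒ repair once more, jointly
with the siblings sharing 14003, by the refuter's variant (3) (Carathéodory pinning of (Ω_δ; a_δ,
b_δ)), which the mechanism does not mind; a SUBSTANTIVE one closes the route and all four siblings'
targets.
¬HexTight is a conjunct-level event shared with the sibling routes; ¬HexTransfer can only be
¬SAWScalingLimit given Conjecture 1 (non-universality ℤ² vs hexagonal of the critical SAW law) — a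
negative decision of the conjunct, not a defect of this line (close `refuted:HexTransfer` together
with every ℤ² route). HexObservableLimitR proved by a sibling
moots layer 1 (close `superseded`); Conjecture 1 proved elsewhere (siblings' node stmt-0808) moots
items 0, 2–6 and leaves HexTransfer, which HexToSquare ∧ LatticeUniversality (siblings) close in one
line; SAWScalingLimit proved on ℤ² directly moots everything.
Negatives honoured: 5420 (this repair), 8312 (disconnected K; RetrievalStabilityR keeps
IsPreconnected), 0772 (all-δ tightness; HexTight is eventual).

NOT DECOMPOSED YET. The passage symbol ⇒ estimate inside RetrievalStabilityR (cut-offs at the patch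
boundary, John–Nirenberg, dependence of ε on η), the
diagonal/η_n bookkeeping and the finiteness of the mid-edge sums in RetrievalSynthesisR, the
honeycomb Riemann sums (edge density 2√3) and
the boundary value F_δ(b_δ) = e^{−iσW_ab}·Z_ab ≠ 0 (discrete Hopf Umlaufsatz, cf.
Literature.Probability.RandomPlanarGeometry.SAW.HV.pturn_walk_eq
in HexSAWHopfPath.lean) and the enlargement of tsupport ψ to a preconnected compact reaching the
anchoring ball in RetrievalSynthesisR, the slit-domain uniformity and rough-b issues inside
ObservableToSLER (incl. passing from roots on flat pieces to the rough tip of the SAW's own slit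
domains), the existence of hexagonal endpoint approximations and the two-ε bookkeeping inside
HexTransfer, and every constant (c, 2√3, the 4 in LocalIsotropy, 0.418) — layer-2 children or prover
lemmas (`--supports`), later.

CHEAPEST FALSIFIER. Two finite computations, both RUN at open (opening planner's session,
2026-08-15; plain python, numbers in that seat's NOTES.md): (i) Bloch symbol of the
linearised real retrieval operator on the honeycomb (4×3 complex matrix Q(k) = [P(k); conj P(−k)],
300² grid of the Brillouin zone):
σ_min(Q(k)) ≥ 0.418·min(|k|, 1), kernel at k = 0 exactly the constants, σ_min = 0.707 at M and 0.866
at K — PASSED (a zero at some k ≠ 0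
would have killed RetrievalStabilityR outright); (ii) exact DCS field (σ = 5/8, x = x_c, SAW
enumeration) in honeycomb balls of graph radius
1–6 (up to V = 64, E = 111): Lemma 1 residual ≤ 1.3e-13, retrieval kernel at the true phase field =
ℝ·|F| exactly (residual 1e-16), second
singular value 0.210, 0.185, 0.159, 0.140, 0.118, 0.103 ≈ 0.42·|k|_min (polynomial, as ellipticity
predicts; exponential decay would have
killed the line) — PASSED. The next cheapest, NOT run (kit job, few CPU-hours): phases of F_δ at
interior mid-edges of a non-symmetric
domain (L-shape, 10³–10⁴ mid-edges by transfer matrix) against −(5/8)(arg φ' − arg φ'(b)) from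
Schwarz–Christoffel: an O(1) class-dependent
discrepancy stable under refinement kills PhaseLawR (the discretisation must be the exact
flat-zigzag half-lattice near the root and near b, e.g. an L-shape with a and b on horizontal edges,
else the test is void — lesson of 5420).

NUMBERS. σ = 5/8, x_c = 1/√(2+√2) (DCS Lemma 1 and Thm 1, both PROVED in the tree); real count: 2V =
4E/3 equations for E moduli, over-determined by
E/3 = number of hexagons = dimension of the complex kernel of the barrier (HexKernel.witness);
LocalIsotropy constant 4 (sharp ≈ 2.65 at
ε = 0.1, ≈ 2.31 as ε → 0, i.e. 4/√3); Bloch lower bound σ_min ≥ 0.418·min(|k|,1) (edge length 1),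
σ_min(M) = 1/√2, σ_min(K) = √3/2; exact-field
second singular values 0.210 … 0.103 for graph radius 1 … 6; Werness's exponents b = 5/8, b̃ = 5/48,
ν = κσ²/2 = 25/48 with b − b̃ − ν = 0,
boundary scaling F_δ(b_δ) ~ δ^{5/4}; κ = 8/3 from 2β + κβ(β−1)/2 = 2α, (α, β) = (5/8, −5/4);
honeycomb mid-edge density 2√3 per unit area
(hexCenter units). Items at open: 13 (1 target, 6 cruxes — 3 new + 3 shared —, 5 support, 1
assembly). After rev 5 (this repair): 13 active items (1 target, 7 cruxes — 3 own + 4 shared —, 5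
support) + the refuted records 5420, 8312. After rev 7 (route choice): 11 active items (1 target —
conjecture-grade, counted as a crux by the gate —, 6 cruxes — 3 own + HexTight, ObservableToSLER
shared + HexTransfer —, 4 support); conjecture-grade total 7 = cap. After rev 10–11 (crux-only
closes): 11 active items (7 cruxes — X + 3 own + HexTight, ObservableToSLER shared + HexTransfer —,
4 support); `closes` hypotheses = X, HexTight, ObservableToSLER, HexTransfer. After rev 12 (gen-4
route choice): 10 active items (7 cruxes, 3 support: RetrievalSynthesisR, RetrievalStabilityDisc,
LocalIsotropy); ProjectiveObservableLimitR 14015 dropped; `closes` unchanged.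

DEFINITION REQUESTS. None: every statement is self-contained over HexParafermion.lean
(hexParafermionicObservable, hexDomainMidEdges/Boundary/SimplyConnected,
hexMidpoint, HexMidEdgeSAW), HexSAW.lean (hexCriticalFugacity, hexSAWLaw, HexDomainSAW,
IsEmbEndpointApprox, HexSAWScalingLimit), the
vertex relations written out verbatim as in the barrier file's SatisfiesVertexRelations (not
imported: that module was being extended while this route was filed), ConformalMap.lean
(ConformalEquiv, HasBoundaryValue), SLEConvergenceCriterion.lean
(IsTightAlongMesh) — all `lean search`-verified; Sketch.lean elaborates (rc 0). Bib entries
GuadieMalinnikova2014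
(doi:10.1007/s40315-014-0076-9) and PriceEtAl2012 (doi:10.1088/1751-8113/45/27/275002) added to
references.bib with `lit cite` + `ledger bib add` (commits 482e85e1cc63, ba3280dbd9f9).

Novelty: Searches (2026-08-15, this session; searchd/OpenAlex/arXiv partly rate-limited or unavailable, noted
in NOTES.md): `lit search "three balls
theorem discrete harmonic functions Guadie Malinnikova"` (8 local + 12 remote: arXiv:1306.1418,
arXiv:1306.1997, arXiv:1512.03732,
arXiv:2003.00491, doi:10.1088/0266-5611/29/7/075018 — discrete conditional stability exists for
discrete HARMONIC functions, with e^{-c/h}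
error terms; nothing for half-holomorphic/parafermionic fields); `lit galaxy search "parafermionic
observable winding phase self-avoiding"
--star all` (0 rows); `lit frontier CriticalPhenomena --since 2020` (30 rows; SAW-relevant only
arXiv:2310.17299); `lit bridges
CriticalPhenomena --cross any` (noise); `lit search --hybrid "parafermionic observable argument
phase winding self-avoiding walk holomorphic"` (10 book hits: Madras–Slade, Lawler, den Hollander,
Slade — none on the mechanism); `lit vsearch` on the phase-determines-modulus phrasing (papers: 0;
all kinds: noise, e.g. bibliography pages of Janse van Rensburg 2015); `lit cite` of
doi:10.1007/s40315-014-0076-9 and doi:10.1088/1751-8113/45/27/275002; all 27 sibling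
route files and the 58 cards of the sub read for overlap; the card's refuter audit (2026-08-15) had
searched crossref/zbMATH for
"parafermionic observable argument phase winding" and read Werness2012 pp. 2, 5, 10, Smirnov
arXiv:1009.6077 §2, §5 and arXiv:0708.0032 §5.
Nearest prior art found: DuminilCopinSmirnov2012 (arXiv:1007.0575: Lemma 1, §4 curl remark  [refs: 10.1088/0266-5611/29/7/075018, 10.1007/s40315-014-0076-9, 10.1088/1751-8113/45/27/275002, 1306.1418, 1306.1997, 1512.03732, 2003.00491, 2310.17299, 1009.6077, 0708.0032, 1007.0575, 1110.3731, doi:10.1088/0266-5611/29/7/075018, doi:10.1007/s40315-014-0076-9, doi:10.1088/1751-8113/45/27/275002, Werness2012, DuminilCopinSmirnov2012, IkhlefCardy2009, PriceEtAl2012, GuadieMalinnikova2014]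

Barriers (technique_class: parafermion-phase, real-overdetermination, cond-stability): - technique_class: parafermion-phase, real-overdetermination, cond-stability
- Literature.Barriers.CriticalPhenomena.ParafermionicHalfCauchyRiemann: APPLIES head-on and is
re-read, not contradicted: its kernel (HexKernel.witness, one complex dimension per hexagon;
`not_determined_of` PROVED) ROTATES phases, so it is excluded by the argument datum — the route
never determines F_δ from vertex relations + boundary values (the barrier's class); it supplies E
real data (PhaseLaw, earned as a crux about the SAW) and proves stability of the complementary real
system (RetrievalStability, a statement about ALL solutions, outside the class because its
hypothesis is the argument field, not boundary values). Honest residue: if PhaseLaw is false the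
barrier wins in substance.
- Literature.Barriers.CriticalPhenomena.ParafermionicHalfCauchyRiemannNarrow: its class is relation
(1) used ONLY as exact lattice identities plus boundary VALUES, and it lists as NOT blocked (b)
identification given convergence/orientation coherence and (c) non-exact complementary input; this
route is of type (c)+(b): the complementary datum is the ARGUMENT field, asymptotic and
model-specific (PhaseLaw), never an exact identity; RetrievalStability uses (1) exactly but in the
fibre {argument = datum}, and the free hexagon circulation
(`exists_sameRelations_sameBoundary_circulation_eq`) moves the argument (LocalIsotropy quantifies
it), so it does not act inside that fibre; the flux identity `hexFlux_eq_zero_of_satisf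

History (route lifecycle, newest last):
- 2026-08-15T23:46:18Z · BROKEN — HexObservableLimit (stmt-CriticalPhenomena-5420, target) refuted by Summit.CriticalPhenomena.SAWScalingLimit.Theorems.SAWDefectDecoherenceHexObservableLimit_refuted @ b90fe791a4c9 (refuter-cdisprove-stmt-CriticalPhenomena-8536-0)
- 2026-08-16T00:00:32Z · rev 5: restated HexObservableLimit (stmt-CriticalPhenomena-5420 refuted), PhaseLaw (stmt-CriticalPhenomena-8311), ObservableToSLE (stmt-CriticalPhenomena-10472), RetrievalSynthesis (stmt-CriticalPhenomena-10722), ProjectiveObservableLimit (stmt-CriticalPhenomena-8314) — repair (rev 5): target HexObservableLimit (stmt-5 (planner-rfix-CriticalPhenomena-SAWPhaseRetri-b3689e38-0)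
- 2026-08-16T00:00:32Z · rev 5: dropped stmt-CriticalPhenomena-8316 — repair (rev 5): target HexObservableLimit (stmt-5420) refuted-MISSTATED by SAWDefectDecoherenceHexObservableLimit_refuted (boundary corridor relocates the confo (planner-rfix-CriticalPhenomena-SAWPhaseRetri-b3689e38-0)
- 2026-08-16T00:00:32Z · REPAIRED (restate HexObservableLimit, PhaseLaw, ObservableToSLE, RetrievalSynthesis, ProjectiveObservableLimit; drop stmt-Critical) — back to open: repair (rev 5): target HexObservableLimit (stmt-5420) refuted-MISSTATED by SAWDefectDecoherenceHexObservableLimit_refuted (boundary corridor relocates the confo (planner-rfix-CriticalPhenomena-SAWPhaseRetri-b3689e38-0)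
- 2026-08-16T00:02:50Z · rev 6: restated HexObservableLimitR (stmt-CriticalPhenomena-14009), PhaseLawR (stmt-CriticalPhenomena-14010), ProjectiveObservableLimitR (stmt-CriticalPhenomena-14012) — repair alignment (rev 6): re-state this route's rev-5 repaired target HexObservableLimitR (14009, 'canonical discretisation in a ball at the root') VE (planner-rfix-CriticalPhenomena-SAWPhaseRetri-b3689e38-0)
- 2026-08-16T03:08:57Z · rev 7: dropped stmt-CriticalPhenomena-10473, stmt-CriticalPhenomena-0808, stmt-CriticalPhenomena-0807 — route-choice (smuggled-conjecture hold 2026-08-16T02:41Z, 9 conjecture-grade > cap 7): option (a) DROP ITEMS, adapted to the reference structure. The two flagge (planner-rchoice-CriticalPhenomena-SAWPhaseRetr-fb82776d-0)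
- 2026-08-16T04:57:41Z · rev 12: dropped ProjectiveObservableLimitR — route-choice (gen 4; smuggled-conjecture hold 2026-08-16T02:41Z): option (a) DROP ITEMS — completed in substance. The two flagged items are settled since revs 7 (planner-rchoice-CriticalPhenomena-SAWPhaseRetr-fb82776d-g4-0)
- 2026-08-26T10:52:11Z · DORMANT — reconciler: no traction for 8.3 d (last activity item-evidence-added at 2026-08-18T02:01:51Z); parked, not closed — `ledger route dormant route-CriticalPhenomen (operator:999:2426224)

sub-problem: SAWScalingLimit · status: dormant · opened planner-plancard-CriticalPhenomena-SAWScaling-9de3607e-0 2026-08-15T12:38:02Z · rev 13 · ledger route-CriticalPhenomena-SAWPhaseRetrieval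
GENERATED by the gate from the ledger (D-0016/17). Provers cite these decls: `theorem foo : Summit.CriticalPhenomena.SAWScalingLimit.Theses.SAWPhaseRetrieval.<Decl> := …` in Summits/CriticalPhenomena/SAWScalingLimit/Theorems/<Name>.lean.
-/

namespace Summit.CriticalPhenomena.SAWScalingLimit.Theses.SAWPhaseRetrieval

open scoped BigOperators Topology Manifold Classical MeasureTheory ProbabilityTheory Matrix InnerProductSpace ComplexConjugate ContinuousMap
open Filter Set Function TopologicalSpace MeasureTheory

attribute [summit_statement] _root_.SAWScalingLimit

-- earlier HexObservableLimitR (stmt-CriticalPhenomena-14009, replaced 2026-08-16T00:02:50Z -> stmt-CriticalPhenomena-14003): retired by None — ∃ c : ℂ, c ≠ 0 ∧ ∀ (D : Literature.Probability.RandomPlanarGeometry.DobrushinDomain) (ρ : ℝ) (Λ : ℝ → Finset Literature.Probability.LatticeModels.HexVertex) (m : ℝ → ℤ) (a b : ℝ → Sym2 Literature.Probability.LatticeModels.HexVertex) (Φ : Literature.Probabilit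
/-- item stmt-CriticalPhenomena-14003 · crux · rank 0 · open · by planner
why it might fail: Conj. 2 open since 2010: fails if the limit 1-form keeps a dz̄ part, if the three edge classes split, or if the b-normalisation oscillates in δ (Kennedy–Lawler); the collar away from the two rigid ρ-balls stays free — a witness moving the conformal geometry from there would re-misstate it.
sources: DuminilCopinSmirnov2012, arXiv:1007.0575, Smirnov2007ICM, KennedyLawler2013, Werness2012, arXiv:0810.2188
[target] repaired HexObservableLimit (stmt-CriticalPhenomena-5420, refuted-misstated by
Summit.CriticalPhenomena.SAWScalingLimit.Theorems.SAWDefectDecoherenceHexObservableLimit_refuted —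
the corridor witness: with Λ_δ free in the o(1)-collar at ∂Ω a boundary-hugging width-1 corridor
with a moat relocates the conformally effective root (3/4 → 1/2 on the half-disc) while every old
hypothesis holds, so the universal c ≠ 0 forces z(p−q)(1−pq) = 0). DCS 2012 Conjecture 2 (hexagonal
lattice), averaged against bulk test functions ψ ∈ C_c(Ω) and normalised at one boundary mid-edge
b_δ, with the ROOT PINNED CONFORMALLY exactly as b already was: for BOTH marked points p_i (i = 0
the root a, i = 1 the normalisation point b) the domain is the horizontal half-plane piece {im z >
im p_i} inside the ball B(p_i, ρ) and the discretisation is the exact half-lattice there (v ∈ Λ_δ ↔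
row(v) ≥ m_i(δ)); otherwise as before — ∃ c ≠ 0 universal with δ²⟨ψ, F_δ⟩/F_δ(b_δ) → c ∫ ψ
exp((5/8)(L − L_b)) for every such Dobrushin domain, every admissible discretisation family (simply
connected, connected, inside Ω, exhausting compacts), boundary mid-edges a_δ → a, b_δ → b, φ: a ↦ ∞,
b ↦ 0, L = log φ' continuous wi -/
@[route_item "route-CriticalPhenomena-SAWPhaseRetrieval", crux]
def HexObservableLimitR : Prop :=
  ∃ c : ℂ, c ≠ 0 ∧ ∀ (D : Literature.Probability.RandomPlanarGeometry.DobrushinDomain) (ρ : ℝ) (Λ : ℝ → Finset Literature.Probability.LatticeModels.HexVertex) (m : Fin 2 → ℝ → ℤ) (a b : ℝ → Sym2 Literature.Probability.LatticeModels.HexVertex) (Φ : Literature.Probability.RandomPlanarGeometry.ConformalEquiv D.carrier UpperHalfPlane.upperHalfPlaneSet) (L : ℂ → ℂ) (Lb : ℂ) (ψ : ℂ → ℂ), let F : ℝ → Sym2 Literature.Probability.LatticeModels.HexVertex → ℂ := fun δ z => Literature.Probability.RandomPlanarGeometry.SAW.hexParafermionicObservable (Λ δ) (a δ) Literature.Probability.RandomPlanarGeometry.SAW.hexCriticalFugacity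 (5 / 8) z; 0 < ρ → (∀ i : Fin 2, D.carrier ∩ Metric.ball (D.pt i) ρ = {z : ℂ | (D.pt i).im < z.im} ∩ Metric.ball (D.pt i) ρ) → (∀ᶠ δ : ℝ in nhdsWithin 0 (Set.Ioi 0), Literature.Probability.RandomPlanarGeometry.SAW.hexDomainSimplyConnected (Λ δ) ∧ a δ ∈ Literature.Probability.RandomPlanarGeometry.SAW.hexDomainBoundary (Λ δ) ∧ b δ ∈ Literature.Probability.RandomPlanarGeometry.SAW.hexDomainBoundary (Λ δ) ∧ Nonempty (Literature.Probability.RandomPlanarGeometry.SAW.HexMidEdgeSAW (Λ δ) (a δ) (b δ)) ∧ (Literature.Probability.LatticeModels.hexGraph.induce ((Λ δ : Finset Literature.Probability.LatticeModels.HexVertex) : Set Literature.Probability.LatticeModels.HexVertex)).Preconnected ∧ (∀ v ∈ Λ δ, (δ : ℂ) * Literature.Probability.LatticeModels.hexCenter v ∈ D.carrier) ∧ (∀ i : Fin 2, ∀ v : Literature.Probability.LatticeModels.HexVertex, (δ : ℂ) * Literature.Probability.LatticeModels.hexCenter v ∈ Metric.ball (D.pt i) ρ → (v ∈ Λ δ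 ↔ m i δ ≤ v.1 1))) → (∀ K : Set ℂ, IsCompact K → K ⊆ D.carrier → ∀ᶠ δ : ℝ in nhdsWithin 0 (Set.Ioi 0), ∀ v : Literature.Probability.LatticeModels.HexVertex, (δ : ℂ) * Literature.Probability.LatticeModels.hexCenter v ∈ K → v ∈ Λ δ) → Filter.Tendsto (fun δ : ℝ => (δ : ℂ) * Literature.Probability.RandomPlanarGeometry.SAW.hexMidpoint (a δ)) (nhdsWithin 0 (Set.Ioi 0)) (nhds (D.pt 0)) → Filter.Tendsto (fun δ : ℝ => (δ : ℂ) * Literature.Probability.RandomPlanarGeometry.SAW.hexMidpoint (b δ)) (nhdsWithin 0 (Set.Ioi 0)) (nhds (D.pt 1)) → Filter.Tendsto (fun x => ‖Φ x‖) (nhdsWithin (D.pt 0) D.carrier) Filter.atTop → Φ.HasBoundaryValue (D.pt 1) 0 → ContinuousOn L D.carrier → (∀ z ∈ D.carrier, Complex.exp (L z) = deriv Φ z) → Filter.Tendsto L (nhdsWithin (D.pt 1) D.carrier) (nhds Lb) → Continuous ψ → HasCompactSupport ψ → tsupport ψ ⊆ D.carrier → Filter.Tendsto (fun δ : ℝ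 => (δ : ℂ) ^ 2 * (∑ᶠ e ∈ Literature.Probability.RandomPlanarGeometry.SAW.hexDomainMidEdges (Λ δ), ψ ((δ : ℂ) * Literature.Probability.RandomPlanarGeometry.SAW.hexMidpoint e) * F δ e) / F δ (b δ)) (nhdsWithin 0 (Set.Ioi 0)) (nhds (c * ∫ z, ψ z * Complex.exp ((5 / 8 : ℂ) * (L z - Lb))))

-- earlier PhaseLawR (stmt-CriticalPhenomena-14010, replaced 2026-08-16T00:02:50Z -> stmt-CriticalPhenomena-14014): retired by None — ∃ u : ℂ, ‖u‖ = 1 ∧ ∀ (D : Literature.Probability.RandomPlanarGeometry.DobrushinDomain) (ρ : ℝ) (Λ : ℝ → Finset Literature.Probability.LatticeModels.HexVertex) (m : ℝ → ℤ) (a b : ℝ → Sym2 Literature.Probability.LatticeModels.HexVertex) (Φ : Literature.Probability.Random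
/-- item stmt-CriticalPhenomena-14014 · crux · rank 2 · open · by planner
why it might fail: Weaker than Conj. 2 but still conformal covariance: hexagonal anisotropy may survive at O(1) in the tilted mean arrival winding (three edge classes, ONE limit), F_δ may vanish on compacts, and no engine beyond restriction/Hadamard-variation heuristics exists at n = 0.
sources: DuminilCopinSmirnov2012, Werness2012, DuplantierSaleur1988, PriceEtAl2012, Smirnov2007ICM, KennedyLawler2013
[crux] repaired PhaseLaw (stmt-CriticalPhenomena-8311, misstated exactly like the target 5420 — in
the corridor witness the ratios F_δ(e)/F_δ(b_δ) are identical for the roots → 1/2 and → 3/4 while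
the predicted phases exp(i(5/8)Im(L_{1/2} − L_{1/2}(0))) and exp(i(5/8)Im(L_{3/4} − L_{3/4}(0)))
differ). SAME statement in the pinned setting of the shared repaired target HexObservableLimitR
(flat horizontal half-plane piece and exact half-lattice rows ≥ m_i(δ) in the ball B(p_i, ρ) at BOTH
marked points, i = 0 root, i = 1 normalisation point). PHASE LAW (card A2): there is ONE universal
unit u (|u| = 1; u = 1 expected, ±1 by reflection symmetry of the flat-zigzag class) such that for
every compact K ⊂ Ω and ε > 0, eventually in δ: F_δ(e) ≠ 0 and the unit vector of F_δ(e)/F_δ(b_δ) is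
within ε of u·exp(i(5/8)·Im(L(δe) − L_b)) for EVERY mid-edge e of Ω_δ in K (all three edge classes:
one common limit) — the argument half of Conjecture 2; probabilistically, the (5/8)-tilted circular
mean of the arrival winding of walks a → e, measured against the fixed winding a → b, tends to −(arg
φ'(z) − arg φ'(b)). The old 8311 implies this statement (Sketch2.lean, P2_of_old). [difficulty:
open-problem] -/
@[route_item "route-CriticalPhenomena-SAWPhaseRetrieval"]
def PhaseLawR : Prop :=
  ∃ u : ℂ, ‖u‖ = 1 ∧ ∀ (D : Literature.Probability.RandomPlanarGeometry.DobrushinDomain) (ρ : ℝ) (Λ : ℝ → Finset Literature.Probability.LatticeModels.HexVertex) (m : Fin 2 → ℝ → ℤ) (a b : ℝ → Sym2 Literature.Probability.LatticeModels.HexVertex) (Φ : Literature.Probability.RandomPlanarGeometry.ConformalEquiv D.carrier UpperHalfPlane.upperHalfPlaneSet) (L : ℂ → ℂ) (Lb : ℂ), let F : ℝ → Sym2 Literature.Probability.LatticeModels.HexVertex → ℂ := fun δ z => Literature.Probability.RandomPlanarGeometry.SAW.hexParafermionicObservable (Λ δ) (a δ) Literature.Probability.RandomPlanarGeometry.SAW.hexCriticalFugacity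 (5 / 8) z; let region : ℝ → Set ℂ → Set (Sym2 Literature.Probability.LatticeModels.HexVertex) := fun δ K => {e | e ∈ Literature.Probability.RandomPlanarGeometry.SAW.hexDomainMidEdges (Λ δ) ∧ (δ : ℂ) * Literature.Probability.RandomPlanarGeometry.SAW.hexMidpoint e ∈ K}; 0 < ρ → (∀ i : Fin 2, D.carrier ∩ Metric.ball (D.pt i) ρ = {z : ℂ | (D.pt i).im < z.im} ∩ Metric.ball (D.pt i) ρ) → (∀ᶠ δ : ℝ in nhdsWithin 0 (Set.Ioi 0), Literature.Probability.RandomPlanarGeometry.SAW.hexDomainSimplyConnected (Λ δ) ∧ a δ ∈ Literature.Probability.RandomPlanarGeometry.SAW.hexDomainBoundary (Λ δ) ∧ b δ ∈ Literature.Probability.RandomPlanarGeometry.SAW.hexDomainBoundary (Λ δ) ∧ Nonempty (Literature.Probability.RandomPlanarGeometry.SAW.HexMidEdgeSAW (Λ δ) (a δ) (b δ)) ∧ (Literature.Probability.LatticeModels.hexGraph.induce ((Λ δ : Finset Literature.Probability.LatticeModels.HexVertex) : Set Literature.Probability.LatticeModels.HexVertex)).Preconnected ∧ (∀ v ∈ Λ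 δ, (δ : ℂ) * Literature.Probability.LatticeModels.hexCenter v ∈ D.carrier) ∧ (∀ i : Fin 2, ∀ v : Literature.Probability.LatticeModels.HexVertex, (δ : ℂ) * Literature.Probability.LatticeModels.hexCenter v ∈ Metric.ball (D.pt i) ρ → (v ∈ Λ δ ↔ m i δ ≤ v.1 1))) → (∀ K : Set ℂ, IsCompact K → K ⊆ D.carrier → ∀ᶠ δ : ℝ in nhdsWithin 0 (Set.Ioi 0), ∀ v : Literature.Probability.LatticeModels.HexVertex, (δ : ℂ) * Literature.Probability.LatticeModels.hexCenter v ∈ K → v ∈ Λ δ) → Filter.Tendsto (fun δ : ℝ => (δ : ℂ) * Literature.Probability.RandomPlanarGeometry.SAW.hexMidpoint (a δ)) (nhdsWithin 0 (Set.Ioi 0)) (nhds (D.pt 0)) → Filter.Tendsto (fun δ : ℝ => (δ : ℂ) * Literature.Probability.RandomPlanarGeometry.SAW.hexMidpoint (b δ)) (nhdsWithin 0 (Set.Ioi 0)) (nhds (D.pt 1)) → Filter.Tendsto (fun x => ‖Φ x‖) (nhdsWithin (D.pt 0) D.carrier) Filter.atTop → Φ.HasBoundaryValue (D.pt 1) 0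 → ContinuousOn L D.carrier → (∀ z ∈ D.carrier, Complex.exp (L z) = deriv Φ z) → Filter.Tendsto L (nhdsWithin (D.pt 1) D.carrier) (nhds Lb) → ∀ K : Set ℂ, IsCompact K → K ⊆ D.carrier → ∀ ε : ℝ, 0 < ε → ∀ᶠ δ : ℝ in nhdsWithin 0 (Set.Ioi 0), ∀ e ∈ region δ K, F δ e ≠ 0 ∧ ‖(F δ e / F δ (b δ)) / ((‖F δ e / F δ (b δ)‖ : ℝ) : ℂ) - u * Complex.exp (Complex.I * (5 / 8 : ℂ) * (((L ((δ : ℂ) * Literature.Probability.RandomPlanarGeometry.SAW.hexMidpoint e) - Lb).im : ℝ) : ℂ))‖ ≤ ε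

/-- item stmt-CriticalPhenomena-10603 · crux · rank 3 · open · by planner
why it might fail: 8312 died on DISCONNECTED K (one scalar per component: G = 1|2, G = S_T1+2S_T2); IsPreconnected K excludes that. Left: δ-uniform interior L¹ estimate for PL (1+O(ε))-quasiregular lattice maps with ε-rotation — no rate in K→1 from AIM 5.5.1/13.4.4; variable-L patching; sup form false.
sources: DuminilCopinSmirnov2012, AstalaIwaniecMartin2008, LehtoVirtanen1973, RodinSullivan1987, arXiv:1306.1418, arXiv:0810.2188
[crux] repaired RetrievalStability (stmt-CriticalPhenomena-8312, refuted-misstated by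
Summit.CriticalPhenomena.SAWScalingLimit.Theorems.SAWPhaseRetrievalRetrievalStability_refuted: the
typed statement let K be DISCONNECTED while ONE scalar s must fit all of K — witnesses G = 1|2 on
two half-planes, and G = S_{T1} + 2 S_{T2} from the identity Σ_x (triEmbed x − z*)·HexKernel.witness
x = −1/3, i.e. constants are sums of local kernel elements). SAME statement with the missing
hypothesis `IsPreconnected K` inserted after `IsCompact K` (covers K = ∅; nothing is lost
downstream: a compact subset of the open connected D.carrier lies in a preconnected compact inside
it — that enlargement is done in ProjectiveSynthesisR). RETRIEVAL STABILITY, L¹ form: for open Ω, L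
holomorphic on Ω, Λ_δ exhausting compacts of Ω, every PRECONNECTED compact K, r > 0 with cthickening
r K ⊆ Ω and η > 0 there is ε > 0 such that for all small δ EVERY G solving the DCS vertex relations
on Λ_δ, non-zero with unit vector within ε of exp(i(5/8)Im L(δe)) on the mid-edges of the
r-thickening, admits s > 0 with δ² Σ_{e∈K} | |G e|/s − |exp((5/8)L(δe))| | ≤ η. REFORMULATION
(planner's reading, for the prover): relation (1) -/
@[route_item "route-CriticalPhenomena-SAWPhaseRetrieval"]
def RetrievalStabilityR : Prop :=
  ∀ (Ω : Set ℂ) (Λ : ℝ → Finset Literature.Probability.LatticeModels.HexVertex) (L : ℂ → ℂ), let region : ℝ → Set ℂ → Set (Sym2 Literature.Probability.LatticeModels.HexVertex) := fun δ K => {e | e ∈ Literature.Probability.RandomPlanarGeometry.SAW.hexDomainMidEdges (Λ δ) ∧ (δ : ℂ) * Literature.Probability.RandomPlanarGeometry.SAW.hexMidpoint e ∈ K}; IsOpen Ω → DifferentiableOn ℂ L Ω → (∀ K : Set ℂ, IsCompact K → K ⊆ Ω → ∀ᶠ δ : ℝ in nhdsWithin 0 (Set.Ioi 0), ∀ v :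 Literature.Probability.LatticeModels.HexVertex, (δ : ℂ) * Literature.Probability.LatticeModels.hexCenter v ∈ K → v ∈ Λ δ) → ∀ K : Set ℂ, IsCompact K → IsPreconnected K → ∀ r : ℝ, 0 < r → Metric.cthickening r K ⊆ Ω → ∀ η : ℝ, 0 < η → ∃ ε : ℝ, 0 < ε ∧ ∀ᶠ δ : ℝ in nhdsWithin 0 (Set.Ioi 0), ∀ G : Sym2 Literature.Probability.LatticeModels.HexVertex → ℂ, (∀ v ∈ Λ δ, ∀ p q r : Literature.Probability.LatticeModels.HexVertex, Literature.Probability.LatticeModels.hexGraph.Adj v p → Literature.Probability.LatticeModels.hexGraph.Adj v q → Literature.Probability.LatticeModels.hexGraph.Adj v r → p ≠ q → q ≠ r → p ≠ r → (Literature.Probability.RandomPlanarGeometry.SAW.hexMidpoint s(v, p) - Literature.Probability.LatticeModels.hexCenter v) * G s(v, p) + (Literature.Probability.RandomPlanarGeometry.SAW.hexMidpoint s(v, q) - Literature.Probability.LatticeModels.hexCenter v) * G s(v, q) + (Literature.Probability.RandomPlanarGeometry.SAW.hexMidpoint s(v, r) - Literature.Probability.LatticeModels.hexCenter v) * G s(v,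 r) = 0) → (∀ e ∈ region δ (Metric.cthickening r K), G e ≠ 0 ∧ ‖G e / ((‖G e‖ : ℝ) : ℂ) - Complex.exp (Complex.I * (5 / 8 : ℂ) * (((L ((δ : ℂ) * Literature.Probability.RandomPlanarGeometry.SAW.hexMidpoint e)).im : ℝ) : ℂ))‖ ≤ ε) → ∃ s : ℝ, 0 < s ∧ δ ^ 2 * (∑ᶠ e ∈ region δ K, |‖G e‖ / s - ‖Complex.exp ((5 / 8 : ℂ) * L ((δ : ℂ) * Literature.Probability.RandomPlanarGeometry.SAW.hexMidpoint e))‖|) ≤ η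

/-- item stmt-CriticalPhenomena-8313 · crux · rank 4 · open · by planner
why it might fail: Hides the exponent conspiracy |F(z)| = mass × |E e^{-iσW}|: the bulk–boundary gap 25/48 must equal the winding decay κσ²/2 with matching amplitudes (Werness b−b̃−ν = 0); Kennedy–Lawler lattice effects could make c depend on more than the zigzag class, or oscillate in δ.
sources: Werness2012, KennedyLawler2013, DuplantierSaleur1988, DuminilCopinSmirnov2012, BeatonGuttmannJensen2012
[crux] BOUNDARY ANCHORING: there is a universal c > 0 such that in the setting of the target (flat
horizontal boundary near b, domain above, discretisation of the flat-zigzag class near b, a_δ → a,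
b_δ → b) for every ε > 0 some closed ball B ⊂ Ω within distance ε of b carries, eventually in δ, |
|F_δ(e)|/|F_δ(b_δ)| − c | ≤ ε for all mid-edges e in B — the one positive scalar left free by
retrieval is pinned through the boundary layer at b (locality of the flat-zigzag boundary layer +
continuity from inside). [difficulty: open-problem] -/
@[route_item "route-CriticalPhenomena-SAWPhaseRetrieval"]
def BoundaryAnchoring : Prop :=
  ∃ c : ℝ, 0 < c ∧ ∀ (D : Literature.Probability.RandomPlanarGeometry.DobrushinDomain) (ρ : ℝ) (Λ : ℝ → Finset Literature.Probability.LatticeModels.HexVertex) (m : ℝ → ℤ) (a b : ℝ → Sym2 Literature.Probability.LatticeModels.HexVertex), let F : ℝ → Sym2 Literature.Probability.LatticeModels.HexVertex → ℂ := fun δ z => Literature.Probability.RandomPlanarGeometry.SAW.hexParafermionicObservable (Λ δ) (a δ) Literature.Probability.RandomPlanarGeometry.SAW.hexCriticalFugacity (5 / 8) z; let region : ℝ → Set ℂ → Set (Sym2 Literature.Probability.LatticeModels.HexVertex) := fun δ K => {e | e ∈ Literature.Probability.RandomPlanarGeometry.SAW.hexDomainMidEdges (Λ δ) ∧ (δ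 : ℂ) * Literature.Probability.RandomPlanarGeometry.SAW.hexMidpoint e ∈ K}; 0 < ρ → D.carrier ∩ Metric.ball (D.pt 1) ρ = {z : ℂ | (D.pt 1).im < z.im} ∩ Metric.ball (D.pt 1) ρ → (∀ᶠ δ : ℝ in nhdsWithin 0 (Set.Ioi 0), Literature.Probability.RandomPlanarGeometry.SAW.hexDomainSimplyConnected (Λ δ) ∧ a δ ∈ Literature.Probability.RandomPlanarGeometry.SAW.hexDomainBoundary (Λ δ) ∧ b δ ∈ Literature.Probability.RandomPlanarGeometry.SAW.hexDomainBoundary (Λ δ) ∧ Nonempty (Literature.Probability.RandomPlanarGeometry.SAW.HexMidEdgeSAW (Λ δ) (a δ) (b δ)) ∧ (Literature.Probability.LatticeModels.hexGraph.induce ((Λ δ : Finset Literature.Probability.LatticeModels.HexVertex) : Set Literature.Probability.LatticeModels.HexVertex)).Preconnected ∧ (∀ v ∈ Λ δ, (δ : ℂ) * Literature.Probability.LatticeModels.hexCenter v ∈ D.carrier) ∧ (∀ v : Literature.Probability.LatticeModels.HexVertex, (δ : ℂ) * Literature.Probability.LatticeModels.hexCenter v ∈ Metric.ball (D.pt 1)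 ρ → (v ∈ Λ δ ↔ m δ ≤ v.1 1))) → (∀ K : Set ℂ, IsCompact K → K ⊆ D.carrier → ∀ᶠ δ : ℝ in nhdsWithin 0 (Set.Ioi 0), ∀ v : Literature.Probability.LatticeModels.HexVertex, (δ : ℂ) * Literature.Probability.LatticeModels.hexCenter v ∈ K → v ∈ Λ δ) → Filter.Tendsto (fun δ : ℝ => (δ : ℂ) * Literature.Probability.RandomPlanarGeometry.SAW.hexMidpoint (a δ)) (nhdsWithin 0 (Set.Ioi 0)) (nhds (D.pt 0)) → Filter.Tendsto (fun δ : ℝ => (δ : ℂ) * Literature.Probability.RandomPlanarGeometry.SAW.hexMidpoint (b δ)) (nhdsWithin 0 (Set.Ioi 0)) (nhds (D.pt 1)) → ∀ ε : ℝ, 0 < ε → ∃ z₀ ∈ D.carrier, ∃ r₀ : ℝ, 0 < r₀ ∧ dist z₀ (D.pt 1) + r₀ < ε ∧ Metric.closedBall z₀ r₀ ⊆ D.carrier ∧ ∀ᶠ δ : ℝ in nhdsWithin 0 (Set.Ioi 0), ∀ e ∈ region δ (Metric.closedBall z₀ r₀), |‖F δ e‖ / ‖F δ (b δ)‖ - c|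 ≤ ε

/-- item stmt-CriticalPhenomena-5423 · crux · rank 5 · open · by planner
why it might fail: No RSW/annulus-crossing technology for SAW (n = 0: no FKG; KS17 §4 covers FK, percolation, harmonic explorer, LERW; G2 fails for UST §4.5); strongest inputs: sub-ballisticity (DCH13, arXiv:2310.17299). Eventual form avoids refuted all-δ item 0772.
sources: KemppainenSmirnov2017, DuminilCopinHammond2013, arXiv:2310.17299, arXiv:1212.6215, Summit.CriticalPhenomena.SAWScalingLimit.Theorems.SAWParafermionTight_refuted
[crux] eventual tightness of the critical hexagonal SAW laws: for every Dobrushin domain and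
hexagonal endpoint approximation (IsEmbEndpointApprox hexGraph hexCenter), the family δ ↦ hexSAWLaw
pushed to CurveClass ℂ is tight along 𝓝[>]0 (IsTightAlongMesh — NOT the refuted all-δ IsTightLaws
form of stmt-CriticalPhenomena-0772). [difficulty: open-problem] -/
@[route_item "route-CriticalPhenomena-SAWPhaseRetrieval", crux]
def HexTight : Prop :=
  ∀ (D : Literature.Probability.RandomPlanarGeometry.DobrushinDomain) (a b : ℝ → Literature.Probability.LatticeModels.HexVertex), Literature.Probability.RandomPlanarGeometry.SAW.IsEmbEndpointApprox Literature.Probability.LatticeModels.hexGraph Literature.Probability.LatticeModels.hexCenter D a b → Literature.Probability.RandomPlanarGeometry.IsTightAlongMesh (fun δ (γ : Literature.Probability.RandomPlanarGeometry.SAW.HexDomainSAW D.carrier δ (a δ) (b δ)) => γ.curve) (fun δ => Literature.Probability.RandomPlanarGeometry.SAW.hexSAWLaw D.carrier δ (a δ) (b δ))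

/-- item stmt-CriticalPhenomena-14005 · crux · rank 6 · open · by planner
why it might fail: The martingale needs the observable limit in the SAW's own slit domains, uniformly (Carathéodory), with a rough tip as root; HexObservableLimitR is per fixed Jordan domain, flat at b. Projective data fix κ = 8/3 but not the drift, so the b-normalisation is load-bearing.
sources: LawlerSchrammWerner2003, KemppainenSmirnov2017, DuminilCopinSmirnov2012Clay, Smirnov2007ICM, DuminilCopinSmirnov2012, arXiv:math/0209343
[crux] the martingale-observable identification for the hexagonal SAW over the repaired target:
HexObservableLimitR → HexTight → (Duminil-Copin–Smirnov 2012 Conjecture 1 written out: for every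
Dobrushin domain and hexagonal endpoint approximation the critical hexagonal SAW law hexSAWLaw,
pushed to CurveClass ℂ, converges in law to chordal SLE(8/3) — verbatim the definiens of Literature
HexSAWScalingLimit and of the shared item HexConjecture, stmt-CriticalPhenomena-0808); re-targeting
for this route of the shared ObservableToSLE (stmt-CriticalPhenomena-10472), which became vacuous
when its antecedent HexObservableLimit was refuted. Intended proof unchanged: the b-normalised
observable ⟨ψ, F_(Ω∖γ[0,n])⟩/F_(Ω∖γ[0,n])(b) is an exact discrete martingale (domain Markov property
of the SAW), its limit c⟨ψ,(φ_n'/φ_n'(b))^(5/8)⟩ forces the driving process of every subsequential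
limit to be √(8/3)B (LSW03 Prop. 5.2 / Itô on g_t'^(5/8)(g_t − W_t)^(−5/4)), and tightness +
uniqueness of the SLE law conclude (SLEConvergenceCriterion). Now explicit as the FIRST step:
bootstrap Conj. 2 from the flat-pinned family of HexObservableLimitR (a, b on horizontal
half-lattice pieces) to Carathéodory-conve -/
@[route_item "route-CriticalPhenomena-SAWPhaseRetrieval", crux]
def ObservableToSLER : Prop :=
  HexObservableLimitR → HexTight → ∀ (D : Literature.Probability.RandomPlanarGeometry.DobrushinDomain) (a b : ℝ → Literature.Probability.LatticeModels.HexVertex), Literature.Probability.RandomPlanarGeometry.SAW.IsEmbEndpointApprox Literature.Probability.LatticeModels.hexGraph Literature.Probability.LatticeModels.hexCenter D a b → Literature.Probability.RandomPlanarGeometry.ConvergesInLawToSLE ((8 : NNReal) / 3) D (fun δ (γ : Literature.Probability.RandomPlanarGeometry.SAW.HexDomainSAW D.carrier δ (a δ) (b δ)) => γ.curve) (fun δ => Literature.Probability.RandomPlanarGeometry.SAW.hexSAWLaw D.carrier δ (a δ) (b δ))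

/-- item stmt-CriticalPhenomena-14221 · crux · rank 9 · open · by planner
why it might fail: Open content = lattice universality: uniform ℤ² SAW lies in no Yang–Baxter/integrable family (GM19 p.1; barrier NienhuisWeightsExcludeVertexSAW), so no transfer tool exists even given the hexagonal SLE(8/3) limit; Kennedy–Lawler boundary lattice effects could split ℤ² endpoint classes.
sources: GlazmanManolescu2019, KennedyLawler2013, DuminilCopinSmirnov2012, LawlerSchrammWerner2004SAW, Literature.Barriers.CriticalPhenomena.NienhuisWeightsExcludeVertexSAW, Literature.Barriers.CriticalPhenomena.not_hasExactVertexRelationZ2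
[crux] LATTICE-UNIVERSALITY TRANSFER (conjecture-grade: filed with kind support at rev 7 only
because the at-edit cap check counted 8 with it declared crux; the gate auto-promotes
conjecture-grade items to crux, intended rank 7 — a retriage follows if needed; rev 7 route choice;
replaces in THIS route the shared tail HexConjecture stmt-0808 → HexToSquare stmt-10473 +
LatticeUniversality stmt-0807, which stays with the sibling routes SAWDefectDecoherence /
SAWResidueField / SAWWindingAlias / SAWDevelopingMap): Duminil-Copin–Smirnov 2012 Conjecture 1 —
written out verbatim as the conclusion of ObservableToSLER (for every Dobrushin domain and hexagonal
endpoint approximation IsEmbEndpointApprox the critical hexagonal SAW law hexSAWLaw, pushed to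
CurveClass ℂ, converges in law to chordal SLE(8/3)) — IMPLIES the δℤ² sub-problem statement
SAWScalingLimit. Universality of the critical SAW scaling limit in exactly the implicational form
the assembly needs: weaker than the asymptotic equality of laws LatticeUniversality (it may use
existence and conformal invariance of the hexagonal limit), Iff.rfl-equivalent to HexConjecture →
SAWScalingLimit, implied by HexToSquare ∧ LatticeUniversality ( -/
@[route_item "route-CriticalPhenomena-SAWPhaseRetrieval", crux]
def HexTransfer : Prop :=
  (∀ (D : Literature.Probability.RandomPlanarGeometry.DobrushinDomain) (a b : ℝ → Literature.Probability.LatticeModels.HexVertex), Literature.Probability.RandomPlanarGeometry.SAW.IsEmbEndpointApprox Literature.Probability.LatticeModels.hexGraph Literature.Probability.LatticeModels.hexCenter D a b → Literature.Probability.RandomPlanarGeometry.ConvergesInLawToSLE ((8 : NNReal) / 3) D (fun δ (γ : Literature.Probability.RandomPlanarGeometry.SAW.HexDomainSAW D.carrier δ (a δ) (b δ)) => γ.curve) (fun δ => Literature.Probability.RandomPlanarGeometry.SAW.hexSAWLaw D.carrier δ (a δ) (b δ))) → SAWScalingLimit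

/-- item stmt-CriticalPhenomena-11413 · support · rank 9 · closed · proved by Summit.CriticalPhenomena.SAWScalingLimit.Theorems.retrievalStabilityDisc_proof @ e6221e733755 (prover) · by planner
sources: DuminilCopinSmirnov2012
[support] RETRIEVAL STABILITY, DISC CASE (special case of the crux RetrievalStabilityR,
stmt-CriticalPhenomena-10603, with Ω = ball 0 3, L = 0, K = closedBall 0 1, r = 1; implied by it by
instantiation — theorem retrievalStabilityDisc_of_R in the planner folder Sketch.lean, rc 0, std
axioms — so strictly weaker and not refutable unless the crux is): for vertex sets Λ_δ exhausting
compacts of the ball of radius 3 and every η > 0 there is ε > 0 such that for all small δ EVERY G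
solving the DCS vertex relations on Λ_δ, non-zero with unit vector within ε of 1 on the mid-edges of
the closed ball of radius 2, admits s > 0 with δ² Σ_{|δ·mid e| ≤ 1} | |G e|/s − 1 | ≤ η. Stepping
stone and the mesh-free heart of the crux: by the structure theorem (solutions = twisted gradients
of a face potential a on the triangular lattice, G(e) = (1/2)conj(c_x′ − c_x)(a_x − a_x′); arg G − π
= rotation of the dual edge, |G| = stretch/2) it says that a piecewise-linear map of a fine
triangulated disc rotating no lattice edge by more than ε is a near-homothety in L¹ on the half
disc, uniformly in the mesh; elementary proof plan (chord lemma f(q) − f(p) = u·∫ρ·(1+O(ε)),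
injectivity on convex sets, image of a -/
@[route_item "route-CriticalPhenomena-SAWPhaseRetrieval"]
def RetrievalStabilityDisc : Prop :=
  ∀ (Λ : ℝ → Finset Literature.Probability.LatticeModels.HexVertex), let region : ℝ → Set ℂ → Set (Sym2 Literature.Probability.LatticeModels.HexVertex) := fun δ K => {e | e ∈ Literature.Probability.RandomPlanarGeometry.SAW.hexDomainMidEdges (Λ δ) ∧ (δ : ℂ) * Literature.Probability.RandomPlanarGeometry.SAW.hexMidpoint e ∈ K}; (∀ K : Set ℂ, IsCompact K → K ⊆ Metric.ball (0 : ℂ) 3 → ∀ᶠ δ : ℝ in nhdsWithin 0 (Set.Ioi 0), ∀ v : Literature.Probability.LatticeModels.HexVertex, (δ : ℂ) * Literature.Probability.LatticeModels.hexCenter v ∈ K → v ∈ Λ δ) → ∀ η : ℝ, 0 < η → ∃ ε : ℝ, 0 < ε ∧ ∀ᶠ δ : ℝ in nhdsWithin 0 (Set.Ioi 0), ∀ G : Sym2 Literature.Probability.LatticeModels.HexVertex → ℂ, (∀ v ∈ Λ δ, ∀ p q r : Literature.Probability.LatticeModels.HexVertex, Literature.Probability.LatticeModels.hexGraph.Adj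 v p → Literature.Probability.LatticeModels.hexGraph.Adj v q → Literature.Probability.LatticeModels.hexGraph.Adj v r → p ≠ q → q ≠ r → p ≠ r → (Literature.Probability.RandomPlanarGeometry.SAW.hexMidpoint s(v, p) - Literature.Probability.LatticeModels.hexCenter v) * G s(v, p) + (Literature.Probability.RandomPlanarGeometry.SAW.hexMidpoint s(v, q) - Literature.Probability.LatticeModels.hexCenter v) * G s(v, q) + (Literature.Probability.RandomPlanarGeometry.SAW.hexMidpoint s(v, r) - Literature.Probability.LatticeModels.hexCenter v) * G s(v, r) = 0) → (∀ e ∈ region δ (Metric.closedBall (0 : ℂ) 2), G e ≠ 0 ∧ ‖G e / ((‖G e‖ : ℝ) : ℂ) - 1‖ ≤ ε) → ∃ s : ℝ, 0 < s ∧ δ ^ 2 * (∑ᶠ e ∈ region δ (Metric.closedBall (0 : ℂ) 1), |‖G e‖ / s - 1|) ≤ η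

-- `RetrievalStabilityDisc` holds: proved by `Summit.CriticalPhenomena.SAWScalingLimit.Theorems.retrievalStabilityDisc_proof` @ e6221e733755 (its module imports this route file, so no `_holds` link can be stated here).

/-- item stmt-CriticalPhenomena-14011 · support · rank 9 · closed · proved by Summit.CriticalPhenomena.SAWScalingLimit.Theorems.retrievalSynthesisR_proof (prover) · by planner
sources: DuminilCopinSmirnov2012, arXiv:0810.2188
[support] layer-1 glue over the repaired decls: PhaseLawR → RetrievalStabilityR → BoundaryAnchoring
→ HexObservableLimitR (replaces RetrievalSynthesis stmt-CriticalPhenomena-10722 and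
AnchoredSynthesis stmt-CriticalPhenomena-8316, both vacuous once 5420 fell; stated over target/crux
decls only because support decls render after them). Proof plan (pure analysis, no probability):
given the repaired target's setting and ψ with K := tsupport ψ ⊆ D.carrier, (i) enlarge K to a
PRECONNECTED compact K' ⊆ D.carrier containing K and a small closed anchoring ball B near b
(D.carrier is open and connected, hence path connected: finitely many closed balls plus connecting
paths), r := infDist(K', D.carrierᶜ)/2 > 0; (ii) L is holomorphic on D.carrier (continuous logarithm
of the non-vanishing holomorphic deriv Φ); (iii) G_δ := F_δ · conj(unit of F_δ(b_δ)) · conj u ·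
e^{i(5/8)Im L_b} keeps the vertex relations at every v ∈ Λ_δ (ℂ-linearity of DCS Lemma 1, PROVED in
the tree: DuminilCopinSmirnov2012_lemma1_holds; a_δ ∈ ∂Ω_δ, Ω_δ simply connected) and by PhaseLawR
has unit vectors within ε of exp(i(5/8)Im L(δe)) on the r-thickening of K', eventually; (iv)
RetrievalStabilityR gives s_δ > 0 with δ² Σ_ -/
@[route_item "route-CriticalPhenomena-SAWPhaseRetrieval"]
def RetrievalSynthesisR : Prop :=
  PhaseLawR → RetrievalStabilityR → BoundaryAnchoring → HexObservableLimitR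

-- `RetrievalSynthesisR` holds: proved by `Summit.CriticalPhenomena.SAWScalingLimit.Theorems.retrievalSynthesisR_proof` (its module imports this route file, so no `_holds` link can be stated here).

/-- item stmt-CriticalPhenomena-8317 · support · rank 9 · closed · proved by Summit.CriticalPhenomena.SAWScalingLimit.Theorems.localIsotropy_proof (prover) · by planner
sources: DuminilCopinSmirnov2012, Literature.Barriers.CriticalPhenomena.ParafermionicHalfCauchyRiemann
[support] LOCAL ISOTROPY (card item (A), triangle closure; provable now): at a honeycomb vertex v
with neighbours p, q, r, if G satisfies the vertex relation at v, the three values are non-zero and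
their unit vectors are within ε ≤ 1/10 of a common unit w, then | |G(vp)|/|G(vq)| − 1 | ≤ 4ε (law of
sines for the closed triangle of the three terms, directions 120° apart, equal arms; numerically the
sharp constant is ≈ 2.65 at ε = 1/10) — the pointwise half of retrieval and the entry lemma for
RetrievalStability. [difficulty: provable-now] -/
@[route_item "route-CriticalPhenomena-SAWPhaseRetrieval"]
def LocalIsotropy : Prop :=
  ∀ (v p q r : Literature.Probability.LatticeModels.HexVertex) (G : Sym2 Literature.Probability.LatticeModels.HexVertex → ℂ) (w : ℂ) (ε : ℝ), Literature.Probability.LatticeModels.hexGraph.Adj v p → Literature.Probability.LatticeModels.hexGraph.Adj v q → Literature.Probability.LatticeModels.hexGraph.Adj v r → p ≠ q → q ≠ r → p ≠ r → ‖w‖ = 1 → 0 ≤ ε → ε ≤ 1 / 10 → (Literature.Probability.RandomPlanarGeometry.SAW.hexMidpoint s(v, p) - Literature.Probability.LatticeModels.hexCenter v) * G s(v, p) + (Literature.Probability.RandomPlanarGeometry.SAW.hexMidpoint s(v, q) - Literature.Probability.LatticeModels.hexCenter v) * G s(v, q) + (Literature.Probability.RandomPlanarGeometry.SAW.hexMidpoint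 s(v, r) - Literature.Probability.LatticeModels.hexCenter v) * G s(v, r) = 0 → G s(v, p) ≠ 0 → G s(v, q) ≠ 0 → G s(v, r) ≠ 0 → ‖G s(v, p) / ((‖G s(v, p)‖ : ℝ) : ℂ) - w‖ ≤ ε → ‖G s(v, q) / ((‖G s(v, q)‖ : ℝ) : ℂ) - w‖ ≤ ε → ‖G s(v, r) / ((‖G s(v, r)‖ : ℝ) : ℂ) - w‖ ≤ ε → |‖G s(v, p)‖ / ‖G s(v, q)‖ - 1| ≤ 4 * ε

-- `LocalIsotropy` holds: proved by `Summit.CriticalPhenomena.SAWScalingLimit.Theorems.localIsotropy_proof` (its module imports this route file, so no `_holds` link can be stated here).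

-- records of items no longer active in this route (dropped / restated):
-- earlier ObservableToSLE (stmt-CriticalPhenomena-10472, replaced 2026-08-16T00:00:32Z -> stmt-CriticalPhenomena-14005): open — HexObservableLimit → HexTight → ∀ (D : Literature.Probability.RandomPlanarGeometry.DobrushinDomain) (a b : ℝ → Literature.Probability.LatticeModels.HexVertex), Literature.Probability.RandomPlanarGeometry.SAW.IsEmbEndpointApprox Literature.Probability.LatticeModels.hexGraph 
-- earlier RetrievalSynthesis (stmt-CriticalPhenomena-10722, replaced 2026-08-16T00:00:32Z -> stmt-CriticalPhenomena-14011): retired by None — PhaseLaw → RetrievalStabilityR → BoundaryAnchoring → HexObservableLimit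
-- earlier ProjectiveObservableLimitR (stmt-CriticalPhenomena-14012, replaced 2026-08-16T00:02:50Z -> stmt-CriticalPhenomena-14015): retired by None — ∀ (D : Literature.Probability.RandomPlanarGeometry.DobrushinDomain) (ρ : ℝ) (Λ : ℝ → Finset Literature.Probability.LatticeModels.HexVertex) (m : ℝ → ℤ) (a b : ℝ → Sym2 Literature.Probability.LatticeModels.HexVertex) (Φ : Literature.Probability.RandomPl
-- earlier HexObservableLimit (stmt-CriticalPhenomena-5420, replaced 2026-08-16T00:00:32Z -> stmt-CriticalPhenomena-14009): refuted by Summit.CriticalPhenomena.SAWScalingLimit.Theorems.SAWDefectDecoherenceHexObservableLimit_refuted @ b90fe791a4c9 — ∃ c : ℂ, c ≠ 0 ∧ ∀ (D : Literature.Probability.RandomPlanarGeometry.DobrushinDomain) (ρ : ℝ) (Λ : ℝ → Finset Literature.Probability.LatticeModels.HexVerte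
-- earlier ObservableToSLE (stmt-CriticalPhenomena-5424, replaced 2026-08-15T17:05:14Z -> stmt-CriticalPhenomena-10472): retired by None — HexObservableLimit → HexTight → Literature.Probability.RandomPlanarGeometry.SAW.HexSAWScalingLimit
-- earlier HexToSquare (stmt-CriticalPhenomena-5428, replaced 2026-08-15T17:05:14Z -> stmt-CriticalPhenomena-10473): retired by None — Literature.Probability.RandomPlanarGeometry.SAW.HexSAWScalingLimit → LatticeUniversality → SAWScalingLimit
-- earlier PhaseLaw (stmt-CriticalPhenomena-8311, replaced 2026-08-16T00:00:32Z -> stmt-CriticalPhenomena-14010): retired by None — ∃ u : ℂ, ‖u‖ = 1 ∧ ∀ (D : Literature.Probability.RandomPlanarGeometry.DobrushinDomain) (ρ : ℝ) (Λ : ℝ → Finset Literature.Probability.LatticeModels.HexVertex) (m : ℝ → ℤ) (a b : ℝ → Sym2 Literature.Probability.LatticeModels.HexVertex) (Φ : Literature.Probability.RandomPl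
-- earlier RetrievalStability (stmt-CriticalPhenomena-8312, dropped 2026-08-15T16:32:30Z): refuted by Summit.CriticalPhenomena.SAWScalingLimit.Theorems.SAWPhaseRetrievalRetrievalStability_refuted @ a3bd4ddd600a — ∀ (Ω : Set ℂ) (Λ : ℝ → Finset Literature.Probability.LatticeModels.HexVertex) (L : ℂ → ℂ), let region : ℝ → Set ℂ → Set (Sym2 Literature.Probability.LatticeModels.HexVertex) := fun δ K => {e
-- earlier ProjectiveObservableLimit (stmt-CriticalPhenomena-8314, replaced 2026-08-16T00:00:32Z -> stmt-CriticalPhenomena-14012): retired by None — ∀ (D : Literature.Probability.RandomPlanarGeometry.DobrushinDomain) (ρ : ℝ) (Λ : ℝ → Finset Literature.Probability.LatticeModels.HexVertex) (m : ℝ → ℤ) (a b : ℝ → Sym2 Literature.Probability.LatticeModels.HexVertex) (Φ : Literature.Probability.RandomPlan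
-- earlier Assembly (stmt-CriticalPhenomena-8318, replaced 2026-08-15T16:32:30Z -> stmt-CriticalPhenomena-10933): retired by None — PhaseLaw → RetrievalStability → ProjectiveSynthesis → BoundaryAnchoring → AnchoredSynthesis → HexTight → ObservableToSLE → HexToSquare → LatticeUniversality → SAWScalingLimit

/-! D-0027 §2.1 — DECIDING THEOREM (planner-authored via `route open/edit --closes-file`; by planner-rchoice-CriticalPhenomena-SAWPhaseRetr-fb82776d-g3-0 2026-08-16T04:27:32Z):
its hypotheses are this route's items and its conclusion the sub-problem Statement (glue_lint), and it elaborates with this file. -/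

@[closes "route-CriticalPhenomena-SAWPhaseRetrieval"] theorem closes (hX : HexObservableLimitR) (hT : HexTight) (hO : ObservableToSLER)
    (hTr : HexTransfer) : _root_.SAWScalingLimit :=
  -- layer 2 (pipeline): ObservableToSLER turns the thesis X = HexObservableLimitR (DCS Conjecture 2,
  -- averaged, pinned) + HexTight into DCS Conjecture 1 on the hexagonal lattice (written out);
  -- HexTransfer carries it to δℤ².  Layer 1 (this route's mechanism) is the registered derivation
  -- RetrievalSynthesisR : PhaseLawR → RetrievalStabilityR → BoundaryAnchoring → HexObservableLimitR,
  -- a support lemma to be PROVED (crux-only rule: it is not a hypothesis here).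
  hTr (hO hX hT)

end Summit.CriticalPhenomena.SAWScalingLimit.Theses.SAWPhaseRetrieval
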